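/-
Origin: expansion seat `prover-pub-hodgecm-mc-sinst-1-g11-0`, handover #1264 2026-08-21T03:02Z md5 31149cea968f (341 l.; NEW additive leaf, ns HodgeCM.Model.ThetaAdelicSide, over the G-datum D₁ := thetaDistDatumOneOfG V c S hGR hGR₀ hGR₁ hGR₂ hGR₃ η₀ η₁ η₂ η₃ hι hV hω hη₁c Φarch harm hdef: §1 def cVOneG/cWOneG η₁ (+_apply), def psiOneG η₁ χ, chiOne_eq_mul_psiOneG, ωfW_/ωfV_oneG_finSBReindex, def coinvEquivOneG (+_mk), coinvRep_coinvEquivOneG (intertwining law), coinvEquivOneG_twist_of_eq, def ΩEquivOneG : (twist (cVOneG η₁) (weilCoinv … ψ splitLineOne.hs ∘ finFrameCongr)).asModule ≃ₗ[adelicAlgebra V] (D₁.coinvRep χ).asModule, iSup_range_coinvRep_oneG_eq, def dictEquivOneOfBigChar (ĉ hĉ hĉV χ'' hχ''); §2 def adelicCharOne η₁ (+_apply), lineVec_dW_one_ne, def bigCharOne, twistCharV_bigCharOne_comp, cmLineChar₁_inl_eq_one, adelicCharOne_eq_one_of_rat (hη₁V), bigCharOne_isRatTrivial, def splitLineOneTwistedG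 (hη₁V), def charOneDictG, def dictEquivOneCanonicalG, dictEquivOneCanonicalG_surjective, iSup_range_coinvRep_oneG_eq_dict; NAMES for audit: HodgeCM.Model.ThetaAdelicSide.coinvRep_coinvEquivOneG · HodgeCM.Model.ThetaAdelicSide.bigCharOne_isRatTrivial · HodgeCM.Model.ThetaAdelicSide.dictEquivOneCanonicalG_surjective) (`HOME/mc/pub-hodgecm-mc-sinst-1-g11/stage70/HodgeCM/Model/AdelicThetaSlotOneBridgeG.lean`, md5 31149cea968f, 341 lines);
landed by the gen-30 packager (p-g30) in gate run 71 as `HodgeCM/Model/AdelicThetaSlotOneBridgeG.lean` (verbatim).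
-/
/-
Copyright (c) 2026 the pub-hodgecm formalisation cell (harness21).  New file, not vendored.
Origin: session prover-pub-hodgecm-mc-sinst-1-g11-0 (unit pub-hodgecm-mc-sinst-1-g11, S-INSTANCE CONSTRUCTOR gen 11; the (J4)↔(J3) BRIDGE of
SLOT 1 re-cut ONCE over the pin-agnostic G-datum (lead 1-g84 ROUTING WORD 2026-08-21T02:34:03Z): the slot character `η₁` is GENERIC, so the
slot is TWISTED in general (`c_{V,1} = η₁(·,1)`, which is `1` at the default split but `ν` at the R2 pin) and lands in the dictionary through a
twisted record, exactly as slot 0 does in #1256), 2026-08-21.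
Intended final place: `HodgeCM/Model/AdelicThetaSlotOneBridgeG.lean` (NEW additive model-layer leaf; imports sinst-1 #1262 `Model/AdelicThetaDistributionOfG`,
#1256 `Model/AdelicThetaDistributionBridgeTwist` (hence #1254, #1255, axioms-1 #8); nothing imports it yet (the slot-1 automorphy sibling will);
drop alone).
-/
import Summits.HodgeConjecture.HodgeCM.Model.AdelicThetaDistributionOfG
import Summits.HodgeConjecture.HodgeCM.Model.AdelicThetaDistributionBridgeTwist

set_option autoImplicit false

/-!
# Slot 1 over the G-datum: the honest module `Ω₁(χ)` is a dictionary carrier at a TWISTED record, for ANY slot character `η₁`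

For any side `S` reading back to `lineRepOf … η₀ η₁ η₂ η₃` (`hω`, `hι`) and the G-datum `D₁ := thetaDistDatumOneOfG … η₁ …` (#1262):
* § 1 `cVOneG ∕ cWOneG ∕ psiOneG` (the slot characters at a GENERIC `η₁`; `chiOne` of #1254 is pin-independent), `coinvEquivOneG`,
  `coinvRep_coinvEquivOneG` (intertwining law), **`ΩEquivOneG : (twist (cVOneG η₁) (Ω(splitLineOne, ψ) ∘ finFrameCongr)).asModule ≃ₗ[adelicAlgebra V]
  Ω₁(χ)`**, blocks equal — #1254 § 3b verbatim with `thetaDistDatumOneOf` ↦ `thetaDistDatumOneOfG`, `eta₁ V c.D η` ↦ `η₁`;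
* § 2 the twisted record (#1256's slot-0 pattern): `adelicCharOne η₁ := η₁(·,1) · χ₁(·,1)` on `U(diag frameD V)(𝔸)`,
  `bigCharOne := LinePair.bigCharOfV … (adelicCharOne η₁)`, `twistCharV_bigCharOne_comp` (its `V`-part along `finFrameCongr` IS `cVOneG η₁`),
  `bigCharOne_isRatTrivial` under the ONE hypothesis **`hη₁V : ∀ v ∈ CMRat (frameD V), η₁ (v, 1) = 1`** (default split: `eta₁ η (v,1) = 1`
  identically; R2 pin: `etaT₁ η ν (v,1) = ν v`, rational by `hν`), `splitLineOneTwistedG`, `dictEquivOneOfBigChar`, **`dictEquivOneTwistedG`**,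
  `charOneDictG χ := twistCharW bigCharOne · psiOneG χ`, **`dictEquivOneCanonicalG`** + `_surjective` — the `adelicAlgebra V`-linear surjection
  binder-2's #101 ∕ #102 socket consumes, slot 1, at every pin.
KERNEL only: 0 records, 0 `def … : Prop`, nothing cited as a hypothesis; `#print axioms` ⊆ {propext, Classical.choice, Quot.sound}.
-/

noncomputable section

open MulAction IsDedekindDomain NumberField.mixedEmbedding
open NumberField hiding relNormOneIdeles relNormOneRat probHaarRelNormOneQuot relNormOneInfUnits relNormOneInfToIdeles
open scoped Matrix TensorProduct Classical SchwartzMap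
open Literature.NumberTheory.Automorphic Literature.NumberTheory.Weil1964
open Literature.NumberTheory.GelbartRogawski1991 Literature.NumberTheory.GelbartRogawski1991.UnitaryDualPair
open Literature.RepresentationTheory (SeesawScalar.twist SeesawScalar.twist_apply)
open Literature.Geometry.ComplexHyperbolic.BallModel (U21 x₀)
open Literature.AlgebraicGeometry.ShimuraVarieties
open HodgeCM.Adelic HodgeCM.PerL34 HodgeCM.Model.ArchSideTerm HodgeCM.Model.ThetaDistFin

namespace HodgeCM.Model
namespace ThetaAdelicSide

variable {L : CMField} {ι₁ : L →+* ℂ} (V : HermSpace3 L ι₁) (c : SeesawCtx L) (S : ThetaAdelicSide V c)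
  (hGR : (cmSplittingDatum (L : Type) finProdFinEquiv (frameD V) (frameD_real V) (frameD_ne V) (dW c.D) (dW_real c.D)
    (dW_ne c.D)).CompatibleSplitting)
  (hGR₀ : (cmSplittingDatum (L : Type) (e₁) (frameD V) (frameD_real V) (frameD_ne V) (lineVec (L : Type) (dW c.D 0))
    (fun _ => dW_real c.D 0) (fun _ => dW_ne c.D 0)).CompatibleSplitting)
  (hGR₁ : (cmSplittingDatum (L : Type) (e₁) (frameD V) (frameD_real V) (frameD_ne V) (lineVec (L : Type) (dW c.D 1))
    (fun _ => dW_real c.D 1) (fun _ => dW_ne c.D 1)).CompatibleSplitting)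
  (hGR₂ : (cmSplittingDatum (L : Type) (e₁) (frameD V) (frameD_real V) (frameD_ne V) (lineVec (L : Type) (dW' c.D 0))
    (fun _ => dW'_real c.D 0) (fun _ => dW'_ne c.D 0)).CompatibleSplitting)
  (hGR₃ : (cmSplittingDatum (L : Type) (e₁) (frameD V) (frameD_real V) (frameD_ne V) (lineVec (L : Type) (dW' c.D 1))
    (fun _ => dW'_real c.D 1) (fun _ => dW'_ne c.D 1)).CompatibleSplitting)
  (η₀ η₁ η₂ η₃ : CMAdelic (L : Type) (frameD V) × CMAdelicOne (L : Type) →* ℂˣ)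
  (hι : S.ιinf = archInfOf V)
  (hV : IsAnisotropic L V.Hm)
  (hω : (S.P 1).ω = lineRepOf V c.D hGR hGR₀ hGR₁ hGR₂ hGR₃ η₀ η₁ η₂ η₃ 1)
  (hη₁c : Continuous fun p => ((η₁ p : ℂˣ) : ℂ))

/-! ## § 1. The slot-1 characters at a generic `η₁` and the coinvariant comparison -/

/-- **`c_{V,1}(η₁) : k ↦ finCharOne η₁ (k, 1)`** — the `U(V)(𝔸_f)`-part of the slot-1 see-saw character for the slot character `η₁`. -/
def cVOneG : ↥V.adelicFin →* ℂˣ :=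
  (finCharOne V c.D hGR hGR₀ hGR₁ η₁).comp (MonoidHom.inl _ _)

/-- **`c_{W,1}(η₁) : u ↦ finCharOne η₁ (1, u)`**. -/
def cWOneG : UfOne c.D →* ℂˣ :=
  (finCharOne V c.D hGR hGR₀ hGR₁ η₁).comp (MonoidHom.inr _ _)

/-- (Ported verbatim from the HodgeCMPerL package; no docstring in the source.) -/
@[simp] theorem cVOneG_apply (g : ↥V.adelicFin) :
    cVOneG V c hGR hGR₀ hGR₁ η₁ g = finCharOne V c.D hGR hGR₀ hGR₁ η₁ (g, 1) := rfl

/-- (Ported verbatim from the HodgeCMPerL package; no docstring in the source.) -/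
@[simp] theorem cWOneG_apply (u : UfOne c.D) :
    cWOneG V c hGR hGR₀ hGR₁ η₁ u = finCharOne V c.D hGR hGR₀ hGR₁ η₁ (1, u) := rfl

/-- **the untwisted dictionary-side character `ψ₁(η₁, χ) := chiOne χ · c_{W,1}(η₁)⁻¹`**. -/
def psiOneG (χ : PontryaginDual (↥(relNormOneIdeles (↥(maximalRealSubfield L)) L) ⧸ relNormOneRat (↥(maximalRealSubfield L)) L)) :
    UfOne c.D →* ℂˣ :=
  chiOne c χ * (cWOneG V c hGR hGR₀ hGR₁ η₁)⁻¹

/-- (Ported verbatim from the HodgeCMPerL package; no docstring in the source.) -/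
theorem chiOne_eq_mul_psiOneG
    (χ : PontryaginDual (↥(relNormOneIdeles (↥(maximalRealSubfield L)) L) ⧸ relNormOneRat (↥(maximalRealSubfield L)) L))
    (u : UfOne c.D) :
    chiOne c χ u = finCharOne V c.D hGR hGR₀ hGR₁ η₁ (1, u) * psiOneG V c hGR hGR₀ hGR₁ η₁ χ u := by
  rw [psiOneG, MonoidHom.mul_apply, MonoidHom.inv_apply, cWOneG_apply, mul_comm (chiOne c χ u), ← mul_assoc, mul_inv_cancel,
    one_mul]

section Coinv

variable (Φarch : Module.Dual ℂ (Fin 2 → ℂ) →ₗ[ℂ] 𝓢((Fin 3 → mixedSpace (↥(maximalRealSubfield L))), ℂ))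
  (harm : ∀ (u : ↥(stabilizer U21 x₀)) (ℓ : Module.Dual ℂ (Fin 2 → ℂ)),
    lineOmega_one V c.D hGR hGR₀ hGR₁ η₁ (u : U21) (Φarch ℓ) =
      Φarch ((BallForms.isPullbackCocycle_cotangentCocycle.weightOf x₀).dual u ℓ))
  (hdef : ∀ a : UnitaryGroup.arch (↥(maximalRealSubfield L)) L (IsCMField.complexConj L) 3 V.Hm,
    UnitaryGroup.archAt (↥(maximalRealSubfield L)) L (IsCMField.complexConj L) 3 V.Hm (UnitaryGroup.cmPlace (L : Type) ι₁)
        (NumberField.complexConj_smul_infinitePlace (L : Type) _) (IsCMField.complexConj_ne_one (L : Type)) a = 1 →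
    ∀ (ℓ : Module.Dual ℂ (Fin 2 → ℂ)) (Φf : FinSB (↥(maximalRealSubfield L)) (Fin 3)),
      lineRepOf V c.D hGR hGR₀ hGR₁ hGR₂ hGR₃ η₀ η₁ η₂ η₃ 1
          (HodgeCM.Adelic.regimeEquiv L V.Hm hV
            (UnitaryGroup.archToAdelic (↥(maximalRealSubfield L)) L (IsCMField.complexConj L) 3 V.Hm a), 1)
          (piSchwartzBruhatEquiv (↥(maximalRealSubfield L)) (Fin 3) (Φarch ℓ ⊗ₜ[ℂ] Φf)) =
        piSchwartzBruhatEquiv (↥(maximalRealSubfield L)) (Fin 3) (Φarch ℓ ⊗ₜ[ℂ] Φf))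
  (χ : PontryaginDual (↥(relNormOneIdeles (↥(maximalRealSubfield L)) L) ⧸ relNormOneRat (↥(maximalRealSubfield L)) L))
  (ψ : UfOne c.D →* ℂˣ)
  (hψ : ∀ u : UfOne c.D, chiOne c χ u = finCharOne V c.D hGR hGR₀ hGR₁ η₁ (1, u) * ψ u)

local notation "D₁" => thetaDistDatumOneOfG V c S hGR hGR₀ hGR₁ hGR₂ hGR₃ η₀ η₁ η₂ η₃ hι hV hω hη₁c Φarch harm hdef

/-- (T-W) `ω_{f,W}(u) (R f) = finCharOne η₁ (1, u) • R (finPairRepW splitLineOne.hs u f)` for the G-datum. -/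
theorem ωfW_oneG_finSBReindex (u : UfOne c.D) (f : FinSB (↥(maximalRealSubfield L)) (Fin 3 × Fin 1)) :
    (D₁).ωfW u (finSBReindex (↥(maximalRealSubfield L)) e₁ f) =
      ((finCharOne V c.D hGR hGR₀ hGR₁ η₁ (1, u) : ℂˣ) : ℂ) •
        finSBReindex (↥(maximalRealSubfield L)) e₁
          (HodgeCM.WeilCoinv.finPairRepW _ _ _ _ _ _ _ _ _ _ _ _ _ _ _ _ _ (splitLineOne V c hGR₁).hs u f) := by
  show finRepOne V c.D hGR hGR₀ hGR₁ η₁ (1, u) _ = _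
  rw [finRepOne_apply, map_one, LinearEquiv.symm_apply_apply]
  rfl

/-- (T-V) `ω_{f,V}(g) (R f) = finCharOne η₁ (g, 1) • R (finPairRepV splitLineOne.hs (finFrameCongr g) f)` for the G-datum. -/
theorem ωfV_oneG_finSBReindex (g : ↥V.adelicFin) (f : FinSB (↥(maximalRealSubfield L)) (Fin 3 × Fin 1)) :
    (D₁).ωfV g (finSBReindex (↥(maximalRealSubfield L)) e₁ f) =
      ((finCharOne V c.D hGR hGR₀ hGR₁ η₁ (g, 1) : ℂˣ) : ℂ) •
        finSBReindex (↥(maximalRealSubfield L)) e₁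
          (HodgeCM.WeilCoinv.finPairRepV _ _ _ _ _ _ _ _ _ _ _ _ _ _ _ _ _ (splitLineOne V c hGR₁).hs
            (finFrameCongr (L : Type) V.Hm (frameG V) (frameD V) (frame_congr V) g) f) := by
  show finRepOne V c.D hGR hGR₀ hGR₁ η₁ (g, 1) _ = _
  rw [finRepOne_apply, LinearEquiv.symm_apply_apply]
  rfl

/-- **THE COINVARIANT COMPARISON OF SLOT 1 (G-datum)**: `Coinv (finPairRepW splitLineOne.hs) ψ ≃ₗ[ℂ] Coinv ω_{f,W} (chiFin χ)` whenever
`chiOne χ = finCharOne η₁ (1, ·) · ψ`. -/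
def coinvEquivOneG :
    TwistedCoinv.Coinv (HodgeCM.WeilCoinv.finPairRepW _ _ _ _ _ _ _ _ _ _ _ _ _ _ _ _ _ (splitLineOne V c hGR₁).hs) ψ ≃ₗ[ℂ]
      TwistedCoinv.Coinv (D₁).ωfW ((D₁).chiFin χ) :=
  TwistedCoinv.mapEquiv _ ψ _ _ (finSBReindex (↥(maximalRealSubfield L)) e₁) (fun u => finCharOne V c.D hGR hGR₀ hGR₁ η₁ (1, u))
    (fun u f => ωfW_oneG_finSBReindex V c S hGR hGR₀ hGR₁ hGR₂ hGR₃ η₀ η₁ η₂ η₃ hι hV hω hη₁c Φarch harm hdef u f) hψ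

/-- (Ported verbatim from the HodgeCMPerL package; no docstring in the source.) -/
@[simp] theorem coinvEquivOneG_mk (f : FinSB (↥(maximalRealSubfield L)) (Fin 3 × Fin 1)) :
    coinvEquivOneG V c S hGR hGR₀ hGR₁ hGR₂ hGR₃ η₀ η₁ η₂ η₃ hι hV hω hη₁c Φarch harm hdef χ ψ hψ (TwistedCoinv.mk _ ψ f) =
      TwistedCoinv.mk _ _ (finSBReindex (↥(maximalRealSubfield L)) e₁ f) := rfl

/-- **THE INTERTWINING LAW (G-datum)**: `Ω₁(χ)(g) (E x) = finCharOne η₁ (g, 1) • E (Ω(splitLineOne, ψ)(finFrameCongr g) x)`. -/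
theorem coinvRep_coinvEquivOneG (g : ↥V.adelicFin)
    (x : TwistedCoinv.Coinv (HodgeCM.WeilCoinv.finPairRepW _ _ _ _ _ _ _ _ _ _ _ _ _ _ _ _ _ (splitLineOne V c hGR₁).hs) ψ) :
    (D₁).coinvRep χ g (coinvEquivOneG V c S hGR hGR₀ hGR₁ hGR₂ hGR₃ η₀ η₁ η₂ η₃ hι hV hω hη₁c Φarch harm hdef χ ψ hψ x) =
      ((finCharOne V c.D hGR hGR₀ hGR₁ η₁ (g, 1) : ℂˣ) : ℂ) •
        coinvEquivOneG V c S hGR hGR₀ hGR₁ hGR₂ hGR₃ η₀ η₁ η₂ η₃ hι hV hω hη₁c Φarch harm hdef χ ψ hψ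
          (HodgeCM.WeilCoinv.weilCoinv _ _ _ _ _ _ _ _ _ _ _ _ _ _ _ _ _ ψ (splitLineOne V c hGR₁).hs
            (finFrameCongr (L : Type) V.Hm (frameG V) (frameD V) (frame_congr V) g) x) :=
  TwistedCoinv.mapEquiv_rep _ ψ _ _
    (HodgeCM.WeilCoinv.finPairRepV _ _ _ _ _ _ _ _ _ _ _ _ _ _ _ _ _ (splitLineOne V c hGR₁).hs) _
    (HodgeCM.WeilCoinv.commute_finPairRepV_finPairRepW _ _ _ _ _ _ _ _ _ _ _ _ _ _ _ _ _ (splitLineOne V c hGR₁).hs)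
    (D₁).commute_ωfV_ωfW _ _ _ hψ
    (fun f => ωfV_oneG_finSBReindex V c S hGR hGR₀ hGR₁ hGR₂ hGR₃ η₀ η₁ η₂ η₃ hι hV hω hη₁c Φarch harm hdef g f) x

/-- the same law against the `c_{V,1}(η₁)`-twisted pullback. -/
theorem coinvEquivOneG_twist_of_eq (cV : ↥V.adelicFin →* ℂˣ) (hcV : cV = cVOneG V c hGR hGR₀ hGR₁ η₁) (g : ↥V.adelicFin)
    (x : TwistedCoinv.Coinv (HodgeCM.WeilCoinv.finPairRepW _ _ _ _ _ _ _ _ _ _ _ _ _ _ _ _ _ (splitLineOne V c hGR₁).hs) ψ) :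
    coinvEquivOneG V c S hGR hGR₀ hGR₁ hGR₂ hGR₃ η₀ η₁ η₂ η₃ hι hV hω hη₁c Φarch harm hdef χ ψ hψ
        (SeesawScalar.twist cV
          ((HodgeCM.WeilCoinv.weilCoinv _ _ _ _ _ _ _ _ _ _ _ _ _ _ _ _ _ ψ (splitLineOne V c hGR₁).hs).comp
            (finFrameCongr (L : Type) V.Hm (frameG V) (frameD V) (frame_congr V))) g x) =
      (D₁).coinvRep χ g (coinvEquivOneG V c S hGR hGR₀ hGR₁ hGR₂ hGR₃ η₀ η₁ η₂ η₃ hι hV hω hη₁c Φarch harm hdef χ ψ hψ x) := by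
  subst hcV
  rw [SeesawScalar.twist_apply, coinvRep_coinvEquivOneG]
  exact map_smul (coinvEquivOneG V c S hGR hGR₀ hGR₁ hGR₂ hGR₃ η₀ η₁ η₂ η₃ hι hV hω hη₁c Φarch harm hdef χ ψ hψ) _ _

include hψ in
/-- **THE BRIDGE OF SLOT 1 (G-datum), module currency**: `(twist c_{V,1}(η₁) (Ω(splitLineOne, ψ) ∘ finFrameCongr)).asModule ≃ₗ[ℂ[U(V)(𝔸_f)]]
Ω₁(χ)`. -/
def ΩEquivOneG :
    (SeesawScalar.twist (cVOneG V c hGR hGR₀ hGR₁ η₁)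
          ((HodgeCM.WeilCoinv.weilCoinv _ _ _ _ _ _ _ _ _ _ _ _ _ _ _ _ _ ψ (splitLineOne V c hGR₁).hs).comp
            (finFrameCongr (L : Type) V.Hm (frameG V) (frameD V) (frame_congr V)))).asModule ≃ₗ[adelicAlgebra V]
      ((D₁).coinvRep χ).asModule :=
  EquivariantLift.liftEquiv _ _ (coinvEquivOneG V c S hGR hGR₀ hGR₁ hGR₂ hGR₃ η₀ η₁ η₂ η₃ hι hV hω hη₁c Φarch harm hdef χ ψ hψ)
    (coinvEquivOneG_twist_of_eq V c S hGR hGR₀ hGR₁ hGR₂ hGR₃ η₀ η₁ η₂ η₃ hι hV hω hη₁c Φarch harm hdef χ ψ hψ _ rfl)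

include hψ in
/-- **BLOCKS EQUAL (slot 1, G-datum)**. -/
theorem iSup_range_coinvRep_oneG_eq {T : Type*} [AddCommMonoid T] [Module ℂ T] [Module (adelicAlgebra V) T]
    [IsScalarTower ℂ (adelicAlgebra V) T] :
    (⨆ f : ((D₁).coinvRep χ).asModule →ₗ[adelicAlgebra V] T, (LinearMap.range f).restrictScalars ℂ) =
      ⨆ f : (SeesawScalar.twist (cVOneG V c hGR hGR₀ hGR₁ η₁)
          ((HodgeCM.WeilCoinv.weilCoinv _ _ _ _ _ _ _ _ _ _ _ _ _ _ _ _ _ ψ (splitLineOne V c hGR₁).hs).comp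
            (finFrameCongr (L : Type) V.Hm (frameG V) (frameD V) (frame_congr V)))).asModule →ₗ[adelicAlgebra V] T,
        (LinearMap.range f).restrictScalars ℂ :=
  (EquivariantLift.iSup_range_eq_of_equiv
    (ΩEquivOneG V c S hGR hGR₀ hGR₁ hGR₂ hGR₃ η₀ η₁ η₂ η₃ hι hV hω hη₁c Φarch harm hdef χ ψ hψ)).symm

/-! ## § 2. The twisted record of slot 1 (for a generic `η₁` the `V`-part `c_{V,1}(η₁) = η₁(·, 1)` need not be trivial) -/

variable (ĉ : (splitLineOne V c hGR₁).BigChar) (hĉ : (splitLineOne V c hGR₁).IsRatTrivial ĉ)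
  (hĉV : (HodgeCM.WeilCoinv.twistCharV (↥(maximalRealSubfield L)) (L : Type) (IsCMField.complexConj L) 3 1
      (Matrix.diagonal (frameD V)) (splitLineOne V c hGR₁).JW ĉ).comp
        (finFrameCongr (L : Type) V.Hm (frameG V) (frameD V) (frame_congr V)) = cVOneG V c hGR hGR₀ hGR₁ η₁)
  (χ'' : (splitLineOne V c hGR₁).CharW)
  (hχ'' : ∀ u, χ'' u =
    HodgeCM.WeilCoinv.twistCharW (↥(maximalRealSubfield L)) (L : Type) (IsCMField.complexConj L) 3 1
      (Matrix.diagonal (frameD V)) (splitLineOne V c hGR₁).JW ĉ u * ψ u)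

include hψ hĉV in
/-- **SLOT 1 LANDS IN THE DICTIONARY THROUGH A TWISTED RECORD**: for a rationally trivial big character `ĉ` of `splitLineOne` with `V`-part
`c_{V,1}(η₁)` along `finFrameCongr` and `χ″ = twistCharW ĉ · ψ`, `Ω(splitLineOne ⊗ ĉ, χ″) ≃ₗ[ℂ[U(V)(𝔸_f)]] Ω₁(χ)`. -/
def dictEquivOneOfBigChar :
    ((splitLineOne V c hGR₁).twistBy ĉ hĉ).Ω (finFrameCongr (L : Type) V.Hm (frameG V) (frameD V) (frame_congr V)) χ''
      ≃ₗ[adelicAlgebra V] ((D₁).coinvRep χ).asModule :=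
  ((splitLineOne V c hGR₁).ΩTwistByEquiv (finFrameCongr (L : Type) V.Hm (frameG V) (frameD V) (frame_congr V)) ĉ hĉ hχ'').trans
    (EquivariantLift.liftEquiv _ _ (coinvEquivOneG V c S hGR hGR₀ hGR₁ hGR₂ hGR₃ η₀ η₁ η₂ η₃ hι hV hω hη₁c Φarch harm hdef χ ψ hψ)
      (coinvEquivOneG_twist_of_eq V c S hGR hGR₀ hGR₁ hGR₂ hGR₃ η₀ η₁ η₂ η₃ hι hV hω hη₁c Φarch harm hdef χ ψ hψ _ hĉV))

end Coinv

/-! ### § 2a. The big character of slot 1 -/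

/-- **the adelic `V`-character of slot 1**: `v ↦ η₁(v, 1) · χ₁(v, 1)` on `U(diag frameD V)(𝔸)` (`χ₁(v,1) = λ₄(1) = 1`, kept for symmetry). -/
def adelicCharOne : CMAdelic (L : Type) (frameD V) →* ℂˣ :=
  η₁.comp (MonoidHom.inl _ _) *
    (cmLineChar₁ (L : Type) finProdFinEquiv e₁ (frameD V) (frameD_real V) (frameD_ne V) (dW c.D) (dW_real c.D) (dW_ne c.D) hGR
        hGR₀ hGR₁).comp (MonoidHom.inl _ _)

/-- (Ported verbatim from the HodgeCMPerL package; no docstring in the source.) -/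
@[simp] theorem adelicCharOne_apply (v : CMAdelic (L : Type) (frameD V)) :
    adelicCharOne V c hGR hGR₀ hGR₁ η₁ v =
      η₁ (v, 1) *
        cmLineChar₁ (L : Type) finProdFinEquiv e₁ (frameD V) (frameD_real V) (frameD_ne V) (dW c.D) (dW_real c.D) (dW_ne c.D) hGR
          hGR₀ hGR₁ (v, 1) := rfl

/-- the line `⟨a₁⟩` has a nonzero Gram entry. -/
theorem lineVec_dW_one_ne : (Matrix.diagonal (lineVec (L : Type) (dW c.D 1))) default default ≠ 0 := by
  rw [Fin.default_eq_zero, Matrix.diagonal_apply_eq]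
  exact dW_ne c.D 1

/-- **THE BIG CHARACTER OF SLOT 1**: `ĉ₁(η₁) := adelicCharOne η₁ ∘ (G₁(𝔸) ≃ U(diag frameD V)(𝔸))` (#1255 `LinePair.bigCharOfV`). -/
def bigCharOne : (splitLineOne V c hGR₁).BigChar :=
  LinePair.bigCharOfV (↥(maximalRealSubfield L)) (L : Type) (IsCMField.complexConj L) 3 (Matrix.diagonal (frameD V))
    (Matrix.diagonal (lineVec (L : Type) (dW c.D 1))) (lineVec_dW_one_ne c) (adelicCharOne V c hGR hGR₀ hGR₁ η₁)

/-- **its `V`-part along `finFrameCongr` is `c_{V,1}(η₁)`**. -/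
theorem twistCharV_bigCharOne_comp :
    (HodgeCM.WeilCoinv.twistCharV (↥(maximalRealSubfield L)) (L : Type) (IsCMField.complexConj L) 3 1
          (Matrix.diagonal (frameD V)) (splitLineOne V c hGR₁).JW (bigCharOne V c hGR hGR₀ hGR₁ η₁)).comp
        (finFrameCongr (L : Type) V.Hm (frameG V) (frameD V) (frame_congr V)) =
      cVOneG V c hGR hGR₀ hGR₁ η₁ := by
  ext g : 1
  rw [MonoidHom.comp_apply, cVOneG_apply, finCharOne_apply, finPairDOne_apply, map_one, map_one]
  show (HodgeCM.WeilCoinv.twistCharV (↥(maximalRealSubfield L)) (L : Type) (IsCMField.complexConj L) 3 1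
      (Matrix.diagonal (frameD V)) (Matrix.diagonal (lineVec (L : Type) (dW c.D 1))) (bigCharOne V c hGR hGR₀ hGR₁ η₁)) _ = _
  rw [bigCharOne, LinePair.twistCharV_bigCharOfV, MonoidHom.comp_apply, adelicCharOne_apply]
  rfl

/-! ### § 2b. Rational triviality of `ĉ₁(η₁)` -/

/-- `χ₁(v, 1) = 1` identically (`cmLineChar₁ = λ₄ ∘ snd`). -/
theorem cmLineChar₁_inl_eq_one (v : CMAdelic (L : Type) (frameD V)) :
    cmLineChar₁ (L : Type) finProdFinEquiv e₁ (frameD V) (frameD_real V) (frameD_ne V) (dW c.D) (dW_real c.D) (dW_ne c.D) hGR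
        hGR₀ hGR₁ (v, 1) = 1 := by
  rw [cmLineChar₁]
  simp only [MonoidHom.coe_comp, Function.comp_apply, MonoidHom.coe_snd, map_one]

variable (hη₁V : ∀ v ∈ CMRat (L : Type) (frameD V), η₁ (v, 1) = 1)

include hη₁V in
/-- **`adelicCharOne η₁ = 1` on `U(diag frameD V)(L⁺)`** under the ONE hypothesis `hη₁V` (the slot character's `V`-part is automorphic). -/
theorem adelicCharOne_eq_one_of_rat {v : CMAdelic (L : Type) (frameD V)} (hv : v ∈ CMRat (L : Type) (frameD V)) :
    adelicCharOne V c hGR hGR₀ hGR₁ η₁ v = 1 := by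
  rw [adelicCharOne_apply, cmLineChar₁_inl_eq_one, mul_one, hη₁V v hv]

include hη₁V in
/-- **`ĉ₁(η₁)` IS RATIONALLY TRIVIAL**. -/
theorem bigCharOne_isRatTrivial : (splitLineOne V c hGR₁).IsRatTrivial (bigCharOne V c hGR hGR₀ hGR₁ η₁) := fun γ₀ =>
  LinePair.bigCharOfV_rationalPairToAdelic' _ _ _ _ _ _ _ _ (fun _ hv => adelicCharOne_eq_one_of_rat V c hGR hGR₀ hGR₁ η₁ hη₁V hv) γ₀

/-- **THE TWISTED INDEX RECORD OF SLOT 1**: `splitLineOne ⊗ ĉ₁(η₁)`. -/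
def splitLineOneTwistedG :
    SplitLine (Matrix.diagonal (frameD V)) (realDiagonal (L : Type) (frameD V) (frameD_real V))
      (complexConj_imagUnit (L : Type)) (imagUnit_ne_zero (L : Type)) (imagUnit_mul_self (L : Type))
      (realDiagonal_isSymm (L : Type) (frameD V) (frameD_real V))
      (isUnit_det_realDiagonal (L : Type) (frameD V) (frameD_real V) (frameD_ne V))
      (realDiagonal_map (L : Type) (frameD V) (frameD_real V)).symm :=
  (splitLineOne V c hGR₁).twistBy (bigCharOne V c hGR hGR₀ hGR₁ η₁) (bigCharOne_isRatTrivial V c hGR hGR₀ hGR₁ η₁ hη₁V)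

/-- **the canonical dictionary character of slot 1 at `(η₁, χ)`**: `χ″₁ := twistCharW ĉ₁(η₁) · ψ₁(η₁, χ)`. -/
def charOneDictG (χ : PontryaginDual (↥(relNormOneIdeles (↥(maximalRealSubfield L)) L) ⧸ relNormOneRat (↥(maximalRealSubfield L)) L)) :
    (splitLineOne V c hGR₁).CharW :=
  HodgeCM.WeilCoinv.twistCharW (↥(maximalRealSubfield L)) (L : Type) (IsCMField.complexConj L) 3 1
      (Matrix.diagonal (frameD V)) (splitLineOne V c hGR₁).JW (bigCharOne V c hGR hGR₀ hGR₁ η₁) *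
    (show (splitLineOne V c hGR₁).CharW from psiOneG V c hGR hGR₀ hGR₁ η₁ χ)

section Canonical

variable (Φarch : Module.Dual ℂ (Fin 2 → ℂ) →ₗ[ℂ] 𝓢((Fin 3 → mixedSpace (↥(maximalRealSubfield L))), ℂ))
  (harm : ∀ (u : ↥(stabilizer U21 x₀)) (ℓ : Module.Dual ℂ (Fin 2 → ℂ)),
    lineOmega_one V c.D hGR hGR₀ hGR₁ η₁ (u : U21) (Φarch ℓ) =
      Φarch ((BallForms.isPullbackCocycle_cotangentCocycle.weightOf x₀).dual u ℓ))
  (hdef : ∀ a : UnitaryGroup.arch (↥(maximalRealSubfield L)) L (IsCMField.complexConj L) 3 V.Hm,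
    UnitaryGroup.archAt (↥(maximalRealSubfield L)) L (IsCMField.complexConj L) 3 V.Hm (UnitaryGroup.cmPlace (L : Type) ι₁)
        (NumberField.complexConj_smul_infinitePlace (L : Type) _) (IsCMField.complexConj_ne_one (L : Type)) a = 1 →
    ∀ (ℓ : Module.Dual ℂ (Fin 2 → ℂ)) (Φf : FinSB (↥(maximalRealSubfield L)) (Fin 3)),
      lineRepOf V c.D hGR hGR₀ hGR₁ hGR₂ hGR₃ η₀ η₁ η₂ η₃ 1
          (HodgeCM.Adelic.regimeEquiv L V.Hm hV
            (UnitaryGroup.archToAdelic (↥(maximalRealSubfield L)) L (IsCMField.complexConj L) 3 V.Hm a), 1)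
          (piSchwartzBruhatEquiv (↥(maximalRealSubfield L)) (Fin 3) (Φarch ℓ ⊗ₜ[ℂ] Φf)) =
        piSchwartzBruhatEquiv (↥(maximalRealSubfield L)) (Fin 3) (Φarch ℓ ⊗ₜ[ℂ] Φf))
  (χ : PontryaginDual (↥(relNormOneIdeles (↥(maximalRealSubfield L)) L) ⧸ relNormOneRat (↥(maximalRealSubfield L)) L))

local notation "D₁" => thetaDistDatumOneOfG V c S hGR hGR₀ hGR₁ hGR₂ hGR₃ η₀ η₁ η₂ η₃ hι hV hω hη₁c Φarch harm hdef

/-- **SLOT 1, CANONICAL FORM (G-datum)**: `Ω(splitLineOne ⊗ ĉ₁(η₁), χ″₁) ≃ₗ[ℂ[U(V)(𝔸_f)]] Ω₁(χ)` — the index pair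
`(splitLineOneTwistedG, charOneDictG χ)` of axioms-1's dictionary at `ιVE V = finFrameCongr` carries EXACTLY the honest slot-1 module of the
G-datum, at every pin. -/
def dictEquivOneCanonicalG :
    (splitLineOneTwistedG V c hGR hGR₀ hGR₁ η₁ hη₁V).Ω (finFrameCongr (L : Type) V.Hm (frameG V) (frameD V) (frame_congr V))
        (charOneDictG V c hGR hGR₀ hGR₁ η₁ χ) ≃ₗ[adelicAlgebra V] ((D₁).coinvRep χ).asModule :=
  dictEquivOneOfBigChar V c S hGR hGR₀ hGR₁ hGR₂ hGR₃ η₀ η₁ η₂ η₃ hι hV hω hη₁c Φarch harm hdef χ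
    (psiOneG V c hGR hGR₀ hGR₁ η₁ χ) (chiOne_eq_mul_psiOneG V c hGR hGR₀ hGR₁ η₁ χ) _ _
    (twistCharV_bigCharOne_comp V c hGR hGR₀ hGR₁ η₁) (charOneDictG V c hGR hGR₀ hGR₁ η₁ χ) fun _ => rfl

/-- hence the `adelicAlgebra V`-linear SURJECTION binder-2's block socket (#101 ∕ #102) consumes, slot 1, any pin. -/
theorem dictEquivOneCanonicalG_surjective :
    Function.Surjective (dictEquivOneCanonicalG V c S hGR hGR₀ hGR₁ hGR₂ hGR₃ η₀ η₁ η₂ η₃ hι hV hω hη₁c hη₁V Φarch harm hdef χ) :=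
  (dictEquivOneCanonicalG V c S hGR hGR₀ hGR₁ hGR₂ hGR₃ η₀ η₁ η₂ η₃ hι hV hω hη₁c hη₁V Φarch harm hdef χ).surjective

/-- **BLOCKS EQUAL (slot 1, dictionary currency, G-datum)**. -/
theorem iSup_range_coinvRep_oneG_eq_dict {T : Type*} [AddCommMonoid T] [Module ℂ T] [Module (adelicAlgebra V) T]
    [IsScalarTower ℂ (adelicAlgebra V) T] :
    (⨆ f : ((D₁).coinvRep χ).asModule →ₗ[adelicAlgebra V] T, (LinearMap.range f).restrictScalars ℂ) =
      ⨆ f : (splitLineOneTwistedG V c hGR hGR₀ hGR₁ η₁ hη₁V).Ω (finFrameCongr (L : Type) V.Hm (frameG V) (frameD V) (frame_congr V))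
          (charOneDictG V c hGR hGR₀ hGR₁ η₁ χ) →ₗ[adelicAlgebra V] T, (LinearMap.range f).restrictScalars ℂ :=
  (EquivariantLift.iSup_range_eq_of_equiv
    (dictEquivOneCanonicalG V c S hGR hGR₀ hGR₁ hGR₂ hGR₃ η₀ η₁ η₂ η₃ hι hV hω hη₁c hη₁V Φarch harm hdef χ)).symm

end Canonical

end ThetaAdelicSide
end HodgeCM.Model

end
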